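import Summits.CriticalPhenomena.CardyFormulaZ2.Theses.CardyMagicRigidity
import Literature.Probability.Percolation.CardyFormulaConformalInvariance
import Literature.Probability.Percolation.BoxCrossingUpperBound
import Literature.Probability.Percolation.ZdNearCriticalWindow
import Literature.Probability.Percolation.HalfSpacePinnedPairs
import Literature.Probability.Percolation.SharpnessDCTProofs
import Literature.Probability.RandomPlanarGeometry.ConformalRectangleProofs
import Summits.CriticalPhenomena.CardyFormulaZ2.Theorems.CardyMagicRigidityLoopsToCrossingsStubCyclicFlip
import Summits.CriticalPhenomena.CardyFormulaZ2.Theorems.CardyMagicRigidityLoopsToCrossingsStubDiscreteCrossingOfPathIn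
import Summits.CriticalPhenomena.CardyFormulaZ2.Theorems.CardyMagicRigidityLoopsToCrossingsStubCardyContinuity
import Summits.CriticalPhenomena.CardyFormulaZ2.Theorems.CardyMagicRigidityLoopsToCrossingsStubNotDiscreteCrossingOfDualPathIn
import Summits.CriticalPhenomena.CardyFormulaZ2.Theorems.CardyMagicRigidityLoopsToCrossingsStubZdPlateDuality
import Literature.Probability.Percolation.FullPlaneCNL
import Literature.Probability.Percolation.AnnulusCrossingBound
import Literature.Probability.Percolation.TriAnnulusCrossing
import Literature.Probability.Percolation.QuadCrossingSquareModel
import Literature.Probability.Percolation.PlateCrossingEvents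

/-!
# Line `oracle-sandwich` — skeleton for crux `LoopsToCrossings` (stmt-CriticalPhenomena-4837)

Route `CardyMagicRigidity`, crux `LoopsToCrossings : X → ∀ R, bond R δ - tri R δ → 0` with
`X = LoopLimitZ2EqT` (full-plane loop universality `ℤ² ~ 𝕋` in DKKMO's `d_CN`).

**Idea (card `oracle-sandwich`, merged by the r1 triage panel with `cardy-sandwich-rado-chart`
and `br-sandwich-diagonal`).** Smirnov's theorem on `𝕋` is proved in the tree for EVERY
conformal rectangle (`hasCrossingLimit_triDomainCrossingProb_holds`), so the subtrahend of the
crux is an oracle: it is enough to show `bond R δ → F(η_R)`. The wild boundary of `R` is handled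
once and for all by the construction-free Bollobás–Riordan sandwich (Ch. 7, Claim 19 + remark
p. 195), whose `𝕋` version is proved in the tree (`mem_triCrossing_of_pathIn`,
`not_mem_triCrossing_compl_of_pathIn`): an open lattice path of a longer–thinner comparison
domain poking out across `arc 0`, `arc 2` of `R` IS a G02 crossing of `R` (stub A, bond port),
and a dual-open (= primal-closed) path of a comparison domain poking out across `arc 1`, `arc 3`
EXCLUDES one (stub B, bond/dual port, Newman's cross-cut theorem).  The comparison domains are
conformal rectangles `Q`, `N` in *sandwich position* with ROOM `r` (stub D: they exist with Cardy
values as close as we please to `F(η_R)`, resp. `1 - F(η_R)` — collar rectangles of a re-marked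
`R` + continuity of the cross-ratio, Radó/Carathéodory), so that the only cross-lattice input is
ONE-SIDED and has four-sided room: stub C, the load-bearing stub and the only place where `X` is
used — a G02 crossing of `Q` on `δ𝕋` forces, up to probability `ε`, an open bond path of `δℤ²`
inside the `r`-fattening of `Q` from the `r`-fattening of `Q.arc 0` to that of `Q.arc 2`.
Bond self-duality at `p = 1/2` (`bondPercolation_half_real_preimage_dualConfig`, tree) turns the
dual-path probability of stub B into the open-path probability that stub C bounds from below.

Composition `LoopsToCrossings_of` (no `sorry`): lower bound
`bond R δ ≥ P[open plate path of Q] ≥ tri Q δ - ε → F(η_Q) - ε ≥ F(η_R) - 2ε`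
(stub A ∘ stub C ∘ Smirnov(Q) ∘ stub D); upper bound
`bond R δ ≤ 1 - P[dual plate path of N] = 1 - P[open plate path of N] ≤ 1 - tri N δ + ε
→ 1 - F(η_N) + ε ≤ F(η_R) + 2ε` (stub B ∘ duality ∘ stub C ∘ Smirnov(N) ∘ stub D); then
`bond R δ → F(η_R)` and `tri R δ → F(η_R)` give the crux.

Disproof.lean (gen 2) honoured: §2 (no `_false_without_X` exists; `X` enters at stub C only),
§4 `hits_not_isClose_robust` (every cross-lattice comparison here has room `r > 0`, fixed before
`δ → 0`), §6 `not_uniformCrossingUniversality` (everything is per rectangle), §5 template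
(the four "sandwich estimates" of `sandwich_transfer` are replaced by the deterministic
inclusions A/B plus the oracle continuity D; no boundary arm estimate appears in this line).
-/

noncomputable section

namespace Summit.CriticalPhenomena.CardyFormulaZ2.Cruxes.LoopsToCrossings.OracleSandwich

open Summit.CriticalPhenomena.CardyFormulaZ2.Theses.CardyMagicRigidity
open Literature.Probability.RandomPlanarGeometry hiding cardyFunction
open Literature.Probability.Percolation hiding cardyFunction
open Literature.Probability.LatticeModels
open Filter Topology Set MeasureTheory Metric

/-! ## The registered stubs (A, B, C; D re-cut as D1, D2, D3 by the lead) -/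

/- Stub A `stub_discreteCrossing_of_pathIn` LANDED (p73826, worker wave 1; prelim Literature p73353
`Literature.Probability.LatticeModels.MeshDomainBigComponents`): imported from
`Summits.CriticalPhenomena.CardyFormulaZ2.Theorems.CardyMagicRigidityLoopsToCrossingsStubDiscreteCrossingOfPathIn`. -/

/- Stub B `stub_not_discreteCrossing_of_dualPathIn` LANDED (p74395, worker wave 1; prelim Literature p73718
`Literature.Probability.Percolation.DualCrosscutBlocking`): imported from
`Summits.CriticalPhenomena.CardyFormulaZ2.Theorems.CardyMagicRigidityLoopsToCrossingsStubNotDiscreteCrossingOfDualPathIn`. -/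

/-- **Stub C — the one-sided cross-lattice transfer WITH ROOM (load-bearing; the only use of
`X`).** Full-plane loop universality `X = LoopLimitZ2EqT` implies: for every conformal rectangle
`Q`, every room `r > 0` and `ε > 0`, eventually in `δ`, the G02 crossing probability of `Q` on
`δ𝕋` is at most `ε` plus the `P_{1/2}`-probability that `δℤ²` carries an open path all of whose
vertices lie in the closed `r`-fattening of `Q`, from the `r`-fattening of `Q.arc 0` to that of
`Q.arc 2` (a "plate path": shorter AND fatter than a crossing of `Q`, four-sided room). No
niceness of `∂Q` is needed: the boundary of `Q` enters only through these three sets. Content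
(the merged residual `C⁺` of the triage panel = `NicePlateComparison` / one-sided
`PlateTransfer` / `TameUniversality`): from `X`, a coupling with `d_CN ≤ η ≪ r` off probability
`η` (`LoopConfig.exists_coupling_of_cnLawEDist_lt`); window confinement of the cluster of a
crossing of `Q` (RSW one-arm decay on `𝕋`); a loop-to-path engine converting `η`-closeness of
the typed loop ensembles near the `𝕋`-crossing into an open bond path within `r` of it
(cluster-shadowing / arc-level trace duality / two-point separation — the lead's choice). Evades
Disproof §4 because the compared events differ by the room `r`, fixed before `δ → 0`. Size L.
[cite: DKKMO2020Rotational, §5.2 p. 25 and §7.1 p. 43] [cite: CamiaNewman2006, §5–6] -/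
theorem stub_transfer_tri_to_bond :
    LoopLimitZ2EqT →
      ∀ (Q : ConformalRectangle) (r : ℝ), 0 < r → ∀ ε : ℝ, 0 < ε →
        ∀ᶠ δ : ℝ in 𝓝[>] 0,
          triDomainCrossingProb Q δ ≤
            (bondPercolation (zdGraph 2) half).real
              (openCrossing {x : Site 2 | meshPoint δ x ∈ cthickening r Q.carrier}
                {x | meshPoint δ x ∈ cthickening r (Q.arc 0)}
                {x | meshPoint δ x ∈ cthickening r (Q.arc 2)}) + ε := by
  sorry

/-! ### Stub C decomposition, first cores (lead reshape 2, 2026-08-16): registered X-free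
lattice lemmas that stub C's proof consumes (plan: `work/C/Plan.lean`, pieces S0 proved, S1–S3
reduced to G1, G2, B1/B2/B2', T1, T2).  Plate events are written with the tree's `openCrossing` /
`siteConnIn` over explicit site sets in the coordinates of a plane homeomorphism `Φ` (a square model
of the quad, `IsSquareModel`); `Icc (-x) x ×ℂ Icc (-y) y` is the plate box. -/

/-- **Stub C-B — plus-position blocking** (X-free, deterministic), three parts.  (ℤ²) a primal
open plate path and a dual open plate path in plus position — the horizontal one joins
`Φ{re ≤ -xin}` to `Φ{xin ≤ re}` inside `Φ([-xout,xout]×[-y,y])`, the vertical one joins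
`Φ{im ≤ -yin}` to `Φ{yin ≤ im}` inside `Φ([-x,x]×[-yout,yout])`, with `x + ν ≤ xin`,
`y + ν ≤ yin` — cannot coexist; (𝕋) the same for an open site path and a closed site path
(`siteConnIn triGraph`, sites drawn by `triMeshPoint δ`); (𝕋/G02) for a square model `Φ` of a
conformal rectangle `Q` (`IsSquareModel Q Φ`), an open (resp. closed) horizontal plate path with
zones `1 + ν ≤ xin` beyond the lateral arcs and height `y + ν ≤ 1` excludes the closed (resp. open)
G02 crossing `triCrossing Q.carrier δ (Q.arc 0) (Q.arc 2)` of the complementary configuration.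
Why true / route: pull back by `Φ⁻¹`; the drawn polylines are connected compact sets crossing
the rectangle `[-x', x'] × [-y', y']` left–right, resp. bottom–top (sub-continuum / passage lemmas
`exists_Icc_passage`, QuadCrossingSquareModel.lean:311), hence meet
(`QuadCrossing.Quad.exists_mem_of_isPreconnected_crossing`, or the rectangle crossing lemma of
`Literature.Topology.PlaneTopology`); but an open primal edge segment never meets an open dual edge
segment (`disjoint_walkTrace_image_edgeTrace`-type facts, BoxCrossingUpperBound.lean), and on `𝕋`
the traces of an open walk and a closed walk are disjoint (`disjoint_segment_triWalkTrace`,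
TriBoxCrossingUpperBound.lean); for G02, a crossing path of `Ω_δ = Q_δ` runs inside
`Q = Φ((-1,1)²)` from within `δ` of `Q.arc 0 = Φ{im = -1}` to within `δ` of `Q.arc 2`
(`triDiscreteArc`).  All for `δ ≤ ρ(Φ, ν)`.  Size M–L. [folklore] -/
theorem stub_plusBlocking :
    (∀ (Φ : ℂ ≃ₜ ℂ) (ν : ℝ), 0 < ν → ∃ δ₀ : ℝ, 0 < δ₀ ∧ ∀ δ : ℝ, 0 < δ → δ ≤ δ₀ →
      ∀ (x yin yout xin xout y : ℝ), 0 < x → x + ν ≤ xin → xin ≤ xout → xout ≤ 2 →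
        0 < y → y + ν ≤ yin → yin ≤ yout → yout ≤ 2 →
        ∀ ω : BondConfig (Site 2), ω ⊆ (zdGraph 2).edgeSet →
          (ω ∈ openCrossing {w : Site 2 | meshPoint δ w ∈ Φ '' (Icc (-x) x ×ℂ Icc (-yout) yout)}
              {w | meshPoint δ w ∈ Φ '' {z : ℂ | z.im ≤ -yin}} {w | meshPoint δ w ∈ Φ '' {z : ℂ | yin ≤ z.im}} →
            dualConfig ω ∈ openCrossing
              {w : Site 2 | dualScale δ (Site.toComplex w) ∈ Φ '' (Icc (-xout) xout ×ℂ Icc (-y) y)}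
              {w | dualScale δ (Site.toComplex w) ∈ Φ '' {z : ℂ | z.re ≤ -xin}}
              {w | dualScale δ (Site.toComplex w) ∈ Φ '' {z : ℂ | xin ≤ z.re}} → False) ∧
          (ω ∈ openCrossing {w : Site 2 | meshPoint δ w ∈ Φ '' (Icc (-xout) xout ×ℂ Icc (-y) y)}
              {w | meshPoint δ w ∈ Φ '' {z : ℂ | z.re ≤ -xin}} {w | meshPoint δ w ∈ Φ '' {z : ℂ | xin ≤ z.re}} →
            dualConfig ω ∈ openCrossing
              {w : Site 2 | dualScale δ (Site.toComplex w) ∈ Φ '' (Icc (-x) x ×ℂ Icc (-yout) yout)}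
              {w | dualScale δ (Site.toComplex w) ∈ Φ '' {z : ℂ | z.im ≤ -yin}}
              {w | dualScale δ (Site.toComplex w) ∈ Φ '' {z : ℂ | yin ≤ z.im}} → False)) ∧
    (∀ (Φ : ℂ ≃ₜ ℂ) (ν : ℝ), 0 < ν → ∃ δ₀ : ℝ, 0 < δ₀ ∧ ∀ δ : ℝ, 0 < δ → δ ≤ δ₀ →
      ∀ (x yin yout xin xout y : ℝ), 0 < x → x + ν ≤ xin → xin ≤ xout → xout ≤ 2 →
        0 < y → y + ν ≤ yin → yin ≤ yout → yout ≤ 2 →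
        ∀ ω : SiteConfig (Site 2),
          ((∃ u ∈ {w : Site 2 | triMeshPoint δ w ∈ Φ '' {z : ℂ | z.im ≤ -yin}},
              ∃ v ∈ {w : Site 2 | triMeshPoint δ w ∈ Φ '' {z : ℂ | yin ≤ z.im}},
                ω ∈ siteConnIn triGraph {w | triMeshPoint δ w ∈ Φ '' (Icc (-x) x ×ℂ Icc (-yout) yout)} u v) →
            (∃ u ∈ {w : Site 2 | triMeshPoint δ w ∈ Φ '' {z : ℂ | z.re ≤ -xin}},
              ∃ v ∈ {w : Site 2 | triMeshPoint δ w ∈ Φ '' {z : ℂ | xin ≤ z.re}},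
                ωᶜ ∈ siteConnIn triGraph {w | triMeshPoint δ w ∈ Φ '' (Icc (-xout) xout ×ℂ Icc (-y) y)} u v) →
            False) ∧
          ((∃ u ∈ {w : Site 2 | triMeshPoint δ w ∈ Φ '' {z : ℂ | z.re ≤ -xin}},
              ∃ v ∈ {w : Site 2 | triMeshPoint δ w ∈ Φ '' {z : ℂ | xin ≤ z.re}},
                ω ∈ siteConnIn triGraph {w | triMeshPoint δ w ∈ Φ '' (Icc (-xout) xout ×ℂ Icc (-y) y)} u v) →
            (∃ u ∈ {w : Site 2 | triMeshPoint δ w ∈ Φ '' {z : ℂ | z.im ≤ -yin}},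
              ∃ v ∈ {w : Site 2 | triMeshPoint δ w ∈ Φ '' {z : ℂ | yin ≤ z.im}},
                ωᶜ ∈ siteConnIn triGraph {w | triMeshPoint δ w ∈ Φ '' (Icc (-x) x ×ℂ Icc (-yout) yout)} u v) →
            False)) ∧
    (∀ (Q : ConformalRectangle) (Φ : ℂ ≃ₜ ℂ), IsSquareModel Q Φ → ∀ ν : ℝ, 0 < ν →
      ∃ δ₀ : ℝ, 0 < δ₀ ∧ ∀ δ : ℝ, 0 < δ → δ ≤ δ₀ →
        ∀ (xin xout y : ℝ), 1 + ν ≤ xin → xin ≤ xout → xout ≤ 2 → 0 < y → y + ν ≤ 1 →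
          ∀ ω : SiteConfig (Site 2),
            ((∃ u ∈ {w : Site 2 | triMeshPoint δ w ∈ Φ '' {z : ℂ | z.re ≤ -xin}},
                ∃ v ∈ {w : Site 2 | triMeshPoint δ w ∈ Φ '' {z : ℂ | xin ≤ z.re}},
                  ω ∈ siteConnIn triGraph {w | triMeshPoint δ w ∈ Φ '' (Icc (-xout) xout ×ℂ Icc (-y) y)} u v) →
              ωᶜ ∈ triCrossing Q.carrier δ (Q.arc 0) (Q.arc 2) → False) ∧
            ((∃ u ∈ {w : Site 2 | triMeshPoint δ w ∈ Φ '' {z : ℂ | z.re ≤ -xin}},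
                ∃ v ∈ {w : Site 2 | triMeshPoint δ w ∈ Φ '' {z : ℂ | xin ≤ z.re}},
                  ωᶜ ∈ siteConnIn triGraph {w | triMeshPoint δ w ∈ Φ '' (Icc (-xout) xout ×ℂ Icc (-y) y)} u v) →
              ω ∈ triCrossing Q.carrier δ (Q.arc 0) (Q.arc 2) → False)) := by
  sorry

/-- **Stub C-G2 — planar duality with room for plate events on `𝕋`** (X-free, deterministic).
Site percolation on `𝕋` at mesh `δ` (sites drawn by `triMeshPoint δ`, paths = `siteConnIn triGraph`
restricted to a site set; the closed paths of `ω` are the open paths of `ωᶜ`): for a chart `Φ` and a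
room `ν > 0`, for all small `δ` and every `ω`: if NO open path drawn inside the plate
`Φ([-x,x] × [-yout,yout])` joins `Φ{im ≤ -yin}` to `Φ{yin ≤ im}`, then SOME closed path drawn inside
`Φ([-x,x] × [-(yin+2ν), yin+2ν])` joins `Φ{re ≤ -(x-2ν)}` to `Φ{x-2ν ≤ re}`; the same with
open/closed exchanged; and the two transposed forms.  Why true / two routes: (i) continuum
duality with a general compact obstacle, `QuadCrossing.Quad.exists_path_avoiding_of_not_crossed`
(QuadCrossingQuadTopology.lean:320) in the chart quad `Φ([-(x-ν),x-ν] × [-(yin+ν),yin+ν])`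
(`exists_quad_of_chart`), obstacle = union of the closed hexagonal cells (Voronoi cells of `𝕋`,
vertices = `δ · hexCenter` of the six faces around the site) of the OPEN sites meeting the quad: a
connected subset of it meeting bottom and top gives a `𝕋`-connected set of open sites (cells meet
only along edges), hence an open plate crossing (contradiction), so some path joins the left side to
the right side through closed cells only, and the closed sites whose cells it visits form the closed
chain; (ii) Bollobás–Riordan's Lemma 5 for 4-marked discrete domains,
`tri_markedDomain_duality_holds` (TriDualityProofs.lean), applied to a `TriMarkedDomain 4` filling
the chart quad with arcs `2ε`-close to its sides (constructor pattern of `level_core` /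
`innerApprox`, TriCollarLevel.lean, or `TriMarkedDomain.ofPolyhex`), then trimming/extension of
paths between the discrete arcs and the plate zones.  All inclusions for `δ ≤ ρ(Φ, ν)`.  Size L.
[folklore] -/
theorem stub_triPlateDuality :
    ∀ (Φ : ℂ ≃ₜ ℂ) (ν : ℝ), 0 < ν → ∃ δ₀ : ℝ, 0 < δ₀ ∧ ∀ δ : ℝ, 0 < δ → δ ≤ δ₀ →
      ∀ ω : SiteConfig (Site 2),
        (∀ x yin yout : ℝ, 2 * ν < x → x ≤ 2 → 0 < yin → yin + 2 * ν ≤ yout → yout ≤ 2 →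
          ((¬ ∃ u ∈ {w : Site 2 | triMeshPoint δ w ∈ Φ '' {z : ℂ | z.im ≤ -yin}},
                ∃ v ∈ {w : Site 2 | triMeshPoint δ w ∈ Φ '' {z : ℂ | yin ≤ z.im}},
                  ω ∈ siteConnIn triGraph {w | triMeshPoint δ w ∈ Φ '' (Icc (-x) x ×ℂ Icc (-yout) yout)} u v) →
            ∃ u ∈ {w : Site 2 | triMeshPoint δ w ∈ Φ '' {z : ℂ | z.re ≤ -(x - 2 * ν)}},
              ∃ v ∈ {w : Site 2 | triMeshPoint δ w ∈ Φ '' {z : ℂ | x - 2 * ν ≤ z.re}},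
                ωᶜ ∈ siteConnIn triGraph
                  {w | triMeshPoint δ w ∈ Φ '' (Icc (-x) x ×ℂ Icc (-(yin + 2 * ν)) (yin + 2 * ν))} u v) ∧
          ((¬ ∃ u ∈ {w : Site 2 | triMeshPoint δ w ∈ Φ '' {z : ℂ | z.im ≤ -yin}},
                ∃ v ∈ {w : Site 2 | triMeshPoint δ w ∈ Φ '' {z : ℂ | yin ≤ z.im}},
                  ωᶜ ∈ siteConnIn triGraph {w | triMeshPoint δ w ∈ Φ '' (Icc (-x) x ×ℂ Icc (-yout) yout)} u v) →
            ∃ u ∈ {w : Site 2 | triMeshPoint δ w ∈ Φ '' {z : ℂ | z.re ≤ -(x - 2 * ν)}},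
              ∃ v ∈ {w : Site 2 | triMeshPoint δ w ∈ Φ '' {z : ℂ | x - 2 * ν ≤ z.re}},
                ω ∈ siteConnIn triGraph
                  {w | triMeshPoint δ w ∈ Φ '' (Icc (-x) x ×ℂ Icc (-(yin + 2 * ν)) (yin + 2 * ν))} u v)) ∧
        (∀ xin xout y : ℝ, 2 * ν < y → y ≤ 2 → 0 < xin → xin + 2 * ν ≤ xout → xout ≤ 2 →
          ((¬ ∃ u ∈ {w : Site 2 | triMeshPoint δ w ∈ Φ '' {z : ℂ | z.re ≤ -xin}},
                ∃ v ∈ {w : Site 2 | triMeshPoint δ w ∈ Φ '' {z : ℂ | xin ≤ z.re}},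
                  ω ∈ siteConnIn triGraph {w | triMeshPoint δ w ∈ Φ '' (Icc (-xout) xout ×ℂ Icc (-y) y)} u v) →
            ∃ u ∈ {w : Site 2 | triMeshPoint δ w ∈ Φ '' {z : ℂ | z.im ≤ -(y - 2 * ν)}},
              ∃ v ∈ {w : Site 2 | triMeshPoint δ w ∈ Φ '' {z : ℂ | y - 2 * ν ≤ z.im}},
                ωᶜ ∈ siteConnIn triGraph
                  {w | triMeshPoint δ w ∈ Φ '' (Icc (-(xin + 2 * ν)) (xin + 2 * ν) ×ℂ Icc (-y) y)} u v) ∧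
          ((¬ ∃ u ∈ {w : Site 2 | triMeshPoint δ w ∈ Φ '' {z : ℂ | z.re ≤ -xin}},
                ∃ v ∈ {w : Site 2 | triMeshPoint δ w ∈ Φ '' {z : ℂ | xin ≤ z.re}},
                  ωᶜ ∈ siteConnIn triGraph {w | triMeshPoint δ w ∈ Φ '' (Icc (-xout) xout ×ℂ Icc (-y) y)} u v) →
            ∃ u ∈ {w : Site 2 | triMeshPoint δ w ∈ Φ '' {z : ℂ | z.im ≤ -(y - 2 * ν)}},
              ∃ v ∈ {w : Site 2 | triMeshPoint δ w ∈ Φ '' {z : ℂ | y - 2 * ν ≤ z.im}},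
                ω ∈ siteConnIn triGraph
                  {w | triMeshPoint δ w ∈ Φ '' (Icc (-(xin + 2 * ν)) (xin + 2 * ν) ×ℂ Icc (-y) y)} u v)) := by
  sorry

/-- **Stub C-T1 — vertical loop sub-arcs transfer from `𝕋` to `ℤ²`** (deterministic, two
configurations; the only places where the COUPLING enters stub C are this stub and its mirror T2).
Data: a chart `Φ`, a room `c > 0`; then a coupling scale `η ≤ η₀(Φ, c)`, a mesh `δ ≤ δ₀`, window radii
`W₀ < W₁` with `Φ([-2,2]²) ⊆ B̄(0, W₀)` and `W₁ + 1 ≤ 1/η`; a bond configuration `ω ⊆ E(ℤ²)` and a site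
configuration `ω'` whose typed loop configurations (`bondLoopConfig δ 0 ω`, DKKMO medial loops of
`δℤ²`; `siteLoopConfig δ ω'`, honeycomb interface loops of `δ𝕋`, both typed by orientation) are
`η`-close in DKKMO's sense (`LoopConfig.IsClose η`: every loop inside `B(0, 1/η)` has a same-type
partner at `udist ≤ η`, both ways), with NO primal/dual arm of `δℤ²` and NO open/closed arm of `δ𝕋`
from `B̄(0,W₀)` to distance `W₁` (tree events `annulusOpenCrossing`, `annulusDualCrossing`,
`triAnnulusCrossing`).  Claim: if `ω'` has an OPEN and a CLOSED vertical plate crossing of the same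
plate `Φ([-x,x] × [-yout,yout])` between the zones `Φ{im ≤ -yin}`, `Φ{yin ≤ im}`, then `ω` has NO
primal and NO dual horizontal plate crossing of any plate whose zones lie `c` beyond `±x` and whose
height is `yin - c`.  Mechanism (see `work/C/Plan.lean`, `TransferVerticalTtoZ`): (1) separation —
let `C` be the open `𝕋`-cluster of the open chain (finite: no long arm); a shortest `𝕋`-path from the
open chain to the closed chain leaves `C` for the last time across an edge `(a, b)`, `a ∈ C` open, `b`
closed and joined to the closed chain off `C`; the site interface loop `L` through that edge
(`exists_isSiteInterfaceLoop_of_adj` for the finite truncation `ω' ∩ B`, which is an honest loop of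
`ω'` because its left chain stays in `C ⊆ B(0, W₁)`) has `loopWind = w` on the open chain and
`w - 1` on the closed chain (`loopWind_triMeshPoint_eq_of_chain`, `loopWind_leftPt_sub_loopWind_rightPt`,
constancy along `C`-avoiding paths: they never cross an edge of `L`); (2) extraction — `L` is a simple
closed polygon (`IsCycle`), its trace separates the two chains inside the strip between them, so
(`Quad.exists_path_avoiding_of_not_crossed` contrapositive = crossing lemma in the chart rectangle
bounded by the two chains and the two zone lines) a connected subset of the trace, hence a PARAMETER
SUB-ARC (connected subsets of a simple closed curve are arcs), joins the two zone lines inside the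
strip; (3) transfer — by `Curve.exists_orientation_shift_reparam_forall_dist_lt` (udist < 2η ⇒
explicit parametrisations 2η-close at every time) the partner medial loop of `ω` has a stretch of
corners whose drawn points are pointwise `2η`-close to that sub-arc; (4) chains — along a stretch of
corners of a medial interface loop the left primal vertices are joined by open edges and the right
faces by dual-open edges (`IsInterfaceLoop.reachable_left`, `LoopBoundaryRegularity.reachable_cFace_iterate_nextCorner`,
localised versions), giving a primal-open AND a dual-open vertical plate crossing of
`Φ([-(x+c/2), x+c/2] × …)` between the zones `∓(yin - c/2)` (chart room: `η, δ ≪ ρ(Φ, c)`);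
(5) blocking — a primal (resp. dual) horizontal crossing with zones beyond `±(x+c)` at heights
`≤ yin - c` would have to cross the dual (resp. primal) vertical one (stub `stub_plusBlocking`, ℤ² part,
which you may ASSUME LANDED and import if it is in the tree when you finish; otherwise reprove the
needed instance).  Size XL⁻. [folklore] -/
theorem stub_transferVerticalTtoZ :
    ∀ (Φ : ℂ ≃ₜ ℂ) (c : ℝ), 0 < c → ∃ η₀ : ℝ, 0 < η₀ ∧ ∀ η : ℝ, 0 < η → η ≤ η₀ →
      ∃ δ₀ : ℝ, 0 < δ₀ ∧ ∀ δ : ℝ, 0 < δ → δ ≤ δ₀ →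
        ∀ (W₀ W₁ : ℝ), Φ '' (Icc (-2) 2 ×ℂ Icc (-2) 2) ⊆ ball (0 : ℂ) W₀ → W₀ < W₁ → W₁ + 1 ≤ 1 / η →
        ∀ (x yin yout : ℝ), c ≤ x → x + c ≤ 2 → 2 * c ≤ yin → yin ≤ yout → yout ≤ 2 →
        ∀ (ω : BondConfig (Site 2)) (ω' : SiteConfig (Site 2)), ω ⊆ (zdGraph 2).edgeSet →
          LoopConfig.IsClose η (bondLoopConfig δ 0 ω) (siteLoopConfig δ ω') →
          (ω ∉ annulusOpenCrossing 0 δ W₀ W₁ ∧ ω ∉ annulusDualCrossing 0 δ W₀ W₁) →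
          (ω' ∉ triAnnulusCrossing true δ 0 W₀ W₁ ∧ ω' ∉ triAnnulusCrossing false δ 0 W₀ W₁) →
          (∃ u ∈ {w : Site 2 | triMeshPoint δ w ∈ Φ '' {z : ℂ | z.im ≤ -yin}},
            ∃ v ∈ {w : Site 2 | triMeshPoint δ w ∈ Φ '' {z : ℂ | yin ≤ z.im}},
              ω' ∈ siteConnIn triGraph {w | triMeshPoint δ w ∈ Φ '' (Icc (-x) x ×ℂ Icc (-yout) yout)} u v) →
          (∃ u ∈ {w : Site 2 | triMeshPoint δ w ∈ Φ '' {z : ℂ | z.im ≤ -yin}},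
            ∃ v ∈ {w : Site 2 | triMeshPoint δ w ∈ Φ '' {z : ℂ | yin ≤ z.im}},
              ω'ᶜ ∈ siteConnIn triGraph {w | triMeshPoint δ w ∈ Φ '' (Icc (-x) x ×ℂ Icc (-yout) yout)} u v) →
          ∀ xout : ℝ, xout ≤ 2 →
            ω ∉ openCrossing {w : Site 2 | meshPoint δ w ∈ Φ '' (Icc (-xout) xout ×ℂ Icc (-(yin - c)) (yin - c))}
                {w | meshPoint δ w ∈ Φ '' {z : ℂ | z.re ≤ -(x + c)}} {w | meshPoint δ w ∈ Φ '' {z : ℂ | x + c ≤ z.re}} ∧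
            dualConfig ω ∉ openCrossing
                {w : Site 2 | dualScale δ (Site.toComplex w) ∈ Φ '' (Icc (-xout) xout ×ℂ Icc (-(yin - c)) (yin - c))}
                {w | dualScale δ (Site.toComplex w) ∈ Φ '' {z : ℂ | z.re ≤ -(x + c)}}
                {w | dualScale δ (Site.toComplex w) ∈ Φ '' {z : ℂ | x + c ≤ z.re}} := by
  sorry

/-! ### Stub C-T2 re-cut (lead reshape 4, 2026-08-16): T2 = T2a (ℤ² extraction of a loop arc)
+ T2b (transfer to 𝕋 + blocking), glued by `transferHorizontalZtoT_of_stubs` (interfaces: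
`Lines/oracle-sandwich-T-plan.lean` = lead's work/C/Transfer.lean).  Plate events in the tree's
vocabulary (`Literature/Probability/Percolation/PlateCrossingEvents.lean`: `plateBox`, `zdPlateH`,
`dualDraw`, `triMonoPlateV`). -/

/-- **Stub C-T2a — a medial loop arc between a primal and a dual horizontal plate crossing**
(pure `ℤ²` + plane topology, deterministic).  If `ω ⊆ E(ℤ²)` (window: no primal/dual arm from
`B̄(0,W₀)` to distance `W₁`) has a primal-open AND a dual-open horizontal crossing of the plate
`Φ(plateBox xout y)` between the zones `Φ{re ≤ -xin}`, `Φ{xin ≤ re}`, then some interface loop `γ`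
of `ω` (trace in `B(0, W₁+1)`) has a based representative `α` (`CurveClass.mk α = loopCurve δ 0 γ`)
and a parameter interval `[s,t]` whose image lies in `Φ(plateBox xin (y + c/2))` and meets
`Φ{re ≤ -(xin - c/2)}` and `Φ{xin - c/2 ≤ re}`.  Route (lead): (separation) counting argument —
along a vertex–face incidence chain from a vertex of the primal chain to a face of the dual chain
every corner lies on exactly one interface loop (its `nextCorner` orbit) and the jump relation
`IsInterfaceLoop.wind_sub_wind_cFace` telescopes, so some orbit loop has different winding numbers
at the two ends (LANDED as `Literature.Probability.Percolation.exists_orbitLoop_wind_ne_of_path`,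
InterfaceLoopSeparation.lean), constant along each chain (`wind_eq_of_adj_of_mem`,
`wind_faceCenter_eq_of_not_mem`); (rounding) Smirnov's rounded Jordan loop `OrbitPolygon.loop`
(OrbitLoopPolygon/OrbitLoopCloseness: Jordan, misses open edges and dual-open dual edges) has the
same winding numbers at lattice points (LANDED: OrbitLoopWinding.lean, `meshPoint_mem_inside_loop_iff`
etc.), so the primal chain's trace is inside and the dual chain's outside, or vice versa
(`IsJordanLoop.subset_inside_or_subset_outside`); (extraction) in the chart rectangle
`[-(xin-c/4), xin-c/4] × [-(y+c/4), y+c/4]`, `PlaneTopology.exists_path_avoiding_of_not_crossed`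
(RectangleDuality) + the crossing lemma give a connected piece of the rounded loop's trace joining
the two vertical sides (a vertical path off the loop would join inside to outside), which is covered
by a cyclic interval of pieces (the three disjointness theorems of OrbitLoopPolygon), whose darts,
after re-basing the orbit loop (`orbitLoop` of a corner of the interval), form the parameter interval.
Size L–XL. [folklore] -/
theorem stub_zdLoopArc :
    ∀ (Φ : ℂ ≃ₜ ℂ) (c : ℝ), 0 < c → ∃ δ₀ : ℝ, 0 < δ₀ ∧ ∀ δ : ℝ, 0 < δ → δ ≤ δ₀ →
      ∀ (W₀ W₁ : ℝ), Φ '' plateBox 2 2 ⊆ ball (0 : ℂ) W₀ → W₀ < W₁ →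
      ∀ (xin xout y : ℝ), 2 * c ≤ xin → xin ≤ xout → xout ≤ 2 → c ≤ y → y + c ≤ 2 →
      ∀ ω : BondConfig (Site 2), ω ⊆ (zdGraph 2).edgeSet →
        (ω ∉ annulusOpenCrossing 0 δ W₀ W₁ ∧ ω ∉ annulusDualCrossing 0 δ W₀ W₁) →
        ω ∈ zdPlateH (meshPoint δ) Φ xin xout y → dualConfig ω ∈ zdPlateH (dualDraw δ) Φ xin xout y →
        ∃ γ : List MedialVertex, IsInterfaceLoop ω γ ∧
          (loopCurve δ 0 γ).range ⊆ ball (0 : ℂ) (W₁ + 1) ∧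
          ∃ (α : Curve ℂ) (s t : unitInterval), CurveClass.mk α = loopCurve δ 0 γ ∧ s ≤ t ∧
            (∀ u ∈ Icc s t, α u ∈ Φ '' plateBox xin (y + c / 2)) ∧
            (∃ u ∈ Icc s t, α u ∈ Φ '' {z : ℂ | z.re ≤ -(xin - c / 2)}) ∧
            (∃ u ∈ Icc s t, α u ∈ Φ '' {z : ℂ | xin - c / 2 ≤ z.re}) := by
  sorry

/-- **Stub C-T2b — a horizontal medial loop arc, `η`-close to the honeycomb loops, blocks every
monochromatic vertical `𝕋` plate crossing** (deterministic).  `IsClose η` gives a honeycomb partner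
loop at unoriented distance `≤ η` (the arc's loop has its trace in `B(0, 1/η)`);
`Curve.exists_orientation_shift_reparam_forall_dist_lt` moves the parameter interval to a connected
stretch of the partner's polygon `polyTrace`, pointwise `2η`-close, hence (chart room) inside the band
`|im| < y + c` and reaching `re < -(xin - c)` and `re > xin - c`; an open (or closed) vertical
crossing of `V(xin - c, y + c, ·)` would meet it (crossing lemma in the chart:
`exists_subcontinuum_between_lines`, `exists_subpath_crossing_levels`,
`exists_mem_of_isPreconnected_crossing`), but centre-to-centre segments of equal-colour neighbours miss
every interface polygon (`IsSiteInterfaceLoop.segment_disjoint_polyTrace_of_mem`).  Size M–L.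
[folklore] -/
theorem stub_triBlockedByCloseArc :
    ∀ (Φ : ℂ ≃ₜ ℂ) (c : ℝ), 0 < c → ∃ η₀ : ℝ, 0 < η₀ ∧ ∀ η : ℝ, 0 < η → η ≤ η₀ →
      ∃ δ₀ : ℝ, 0 < δ₀ ∧ ∀ δ : ℝ, 0 < δ → δ ≤ δ₀ →
      ∀ (xin y : ℝ), 2 * c ≤ xin → xin ≤ 2 → c ≤ y → y + c ≤ 2 →
      ∀ (ω : BondConfig (Site 2)) (ω' : SiteConfig (Site 2)),
        LoopConfig.IsClose η (bondLoopConfig δ 0 ω) (siteLoopConfig δ ω') →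
        ∀ γ : List MedialVertex, IsInterfaceLoop ω γ → (loopCurve δ 0 γ).range ⊆ ball (0 : ℂ) (1 / η) →
          ∀ (α : Curve ℂ) (s t : unitInterval), CurveClass.mk α = loopCurve δ 0 γ → s ≤ t →
            (∀ u ∈ Icc s t, α u ∈ Φ '' plateBox xin (y + c / 2)) →
            (∃ u ∈ Icc s t, α u ∈ Φ '' {z : ℂ | z.re ≤ -(xin - c / 2)}) →
            (∃ u ∈ Icc s t, α u ∈ Φ '' {z : ℂ | xin - c / 2 ≤ z.re}) →
            ∀ yout' : ℝ, yout' ≤ 2 → ω' ∉ triMonoPlateV Φ δ (xin - c) (y + c) yout' := by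
  sorry

/-- **T2 — horizontal loop sub-arcs transfer from `ℤ²` to `𝕋`, from T2a and T2b** (the statement
consumed by stub C's plan as `TransferHorizontalZtoT`, in the tree's plate vocabulary; the glue is the
lead's `transferHorizontalZtoT_of`). [folklore] -/
theorem transferHorizontalZtoT_of_stubs :
    ∀ (Φ : ℂ ≃ₜ ℂ) (c : ℝ), 0 < c → ∃ η₀ : ℝ, 0 < η₀ ∧ ∀ η : ℝ, 0 < η → η ≤ η₀ →
      ∃ δ₀ : ℝ, 0 < δ₀ ∧ ∀ δ : ℝ, 0 < δ → δ ≤ δ₀ →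
        ∀ (W₀ W₁ : ℝ), Φ '' plateBox 2 2 ⊆ ball (0 : ℂ) W₀ → W₀ < W₁ → W₁ + 1 ≤ 1 / η →
        ∀ (xin xout y : ℝ), 2 * c ≤ xin → xin ≤ xout → xout ≤ 2 → c ≤ y → y + c ≤ 2 →
        ∀ (ω : BondConfig (Site 2)) (ω' : SiteConfig (Site 2)), ω ⊆ (zdGraph 2).edgeSet →
          LoopConfig.IsClose η (bondLoopConfig δ 0 ω) (siteLoopConfig δ ω') →
          (ω ∉ annulusOpenCrossing 0 δ W₀ W₁ ∧ ω ∉ annulusDualCrossing 0 δ W₀ W₁) →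
          (ω' ∉ triAnnulusCrossing true δ 0 W₀ W₁ ∧ ω' ∉ triAnnulusCrossing false δ 0 W₀ W₁) →
          ω ∈ zdPlateH (meshPoint δ) Φ xin xout y → dualConfig ω ∈ zdPlateH (dualDraw δ) Φ xin xout y →
          ∀ yout' : ℝ, yout' ≤ 2 → ω' ∉ triMonoPlateV Φ δ (xin - c) (y + c) yout' := by
  intro Φ c hc
  obtain ⟨η₁, hη₁, hB1⟩ := stub_triBlockedByCloseArc Φ c hc
  refine ⟨η₁, hη₁, fun η hη hηle ↦ ?_⟩
  obtain ⟨δa, hδa, hA'⟩ := stub_zdLoopArc Φ c hc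
  obtain ⟨δ₁, hδ₁, hB1'⟩ := hB1 η hη hηle
  refine ⟨min δa δ₁, lt_min hδa hδ₁, fun δ hδ hδle ↦ ?_⟩
  intro W₀ W₁ hW hW₀₁ hηW xin xout y hxin hxio hxout hy hy2 ω ω' hE hC hwz _hwt hHp hHd yout' hyout'
  obtain ⟨γ, hγ, hrange, α, s, t, hα, hst, hband, hleft, hright⟩ :=
    hA' δ hδ (hδle.trans (min_le_left _ _)) W₀ W₁ hW hW₀₁ xin xout y hxin hxio hxout hy hy2 ω hE hwz hHp hHd
  have hrange' : (loopCurve δ 0 γ).range ⊆ ball (0 : ℂ) (1 / η) :=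
    hrange.trans (ball_subset_ball hηW)
  exact hB1' δ hδ (hδle.trans (min_le_right _ _)) xin y hxin (hxio.trans hxout) hy hy2 ω ω' hC γ hγ
    hrange' α s t hα hst hband hleft hright yout' hyout'

/-! ### Stub D re-cut (lead reshape 1, 2026-08-16): D1 Cardy continuity + D2 comparison
geometry + D3 cyclic flip, glued below (`comparisonRectangles_of_stubs`) to the statement consumed by
`tendsto_sub_of_stubs`.  Reason: the planner's construction for D (collar rectangle of the re-marked
`R`) has its four corners ON `∂R`, so D's cap clause `∀ z ∈ cthickening r (Q.arc 0), z ∉ R.carrier`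
fails near the corners for every `r > 0`; D2 asks instead for a GENERAL tube profile whose poke-out
covers the re-marked corners, and the Cardy clauses are supplied by D1/D3 (pure analysis). -/

/- Stub D1 `stub_cardyContinuity` LANDED (p74311, worker wave 1; prelim Literature p73871
`Literature.Probability.RandomPlanarGeometry.CrossRatioContinuity`): imported from
`Summits.CriticalPhenomena.CardyFormulaZ2.Theorems.CardyMagicRigidityLoopsToCrossingsStubCardyContinuity`. -/

/-- **Stub D2 — comparison quads in sandwich position, by a general tube profile** (conformal-tube
geometry only, X-free; no Cardy values).  For every conformal rectangle `R` and closeness budget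
`ε₀ > 0` there is a lateral margin `m > 0` such that for every plate margin `t > 0`: (lower) a conformal
rectangle `Q` and a room `r > 0` with boundary loop uniformly `ε₀`-close to `R.boundary` and marks
`ε₀`-close to `R.mark`, in LOWER sandwich position (its `r`-fattening lies, off `Ω`, within `t` of
`arc 0 ∪ arc 2` and, in `Ω`, `m`-off `arc 1 ∪ arc 3`; its fattened end arcs are OFF `Ω` and `t`-close
to `arc 0`, resp. `arc 2`); (upper) a conformal rectangle `N`, room `r > 0`, with boundary loop
uniformly `ε₀`-close to the SHIFTED loop `u ↦ R.boundary (u + R.mark 1)` and marks `ε₀`-close to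
`(0, m₂ - m₁, m₃ - m₁, m₀ + 1 - m₁)`, in upper sandwich position w.r.t. the arcs `1, 3` of `R` (with the
corner clause).  Construction: boundary loop `u ↦ T.tube (p u) u` (`JordanDomain.nonempty_tubeData`,
`TubeData.injOn_tube`, `JordanDomain.ofLoop`) for a continuous `1`-periodic profile `p` with values in
`[1 - h, 1 + θ]`: `p = 1 + θ` on a parameter interval slightly LARGER than the re-marked arc `0`
(`[mark 0 + s, mark 1 - s]`, marks of `Q`) — so the whole closed arc `0` of `Q`, corners included,
lies outside `closure Ω` (`tube_not_mem_closure`) at positive distance, which is what the cap clause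
needs — crossing level `1` inside the parameter range of `R.arc 0` and equal to `1 - h` along the
parameter ranges of `R.arc 1`, `R.arc 3`; `s, h` are fixed by `ε₀` (`exists_dist_tube_lt`), `m` by
`s, h` (`exists_le_infDist_tube_inner`, distance of `R.boundary '' [mark 1 - s/2, mark 1]` from
`R.arc 1` minus corners is not needed: points of `Q` inside `Ω` near its lateral arcs are near
`R.boundary (mark 1 - s/2) ∈ R.arc 0 ∖ {corners}`), the poke-out `θ ↓ 0` realises any `t`, and `r` is
chosen last; `N` is the same construction for the shifted parametrisation.  Size L.
[cite: BollobasRiordan2006, Ch. 7 Lemma 14 p. 184 and p. 186 (Fig. 14)] -/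
theorem stub_comparisonGeometry :
    ∀ (R : ConformalRectangle) (ε₀ : ℝ), 0 < ε₀ → ∃ m : ℝ, 0 < m ∧ ∀ t : ℝ, 0 < t →
      (∃ (Q : ConformalRectangle) (r : ℝ), 0 < r ∧
          (∀ u : ℝ, dist (Q.boundary u) (R.boundary u) ≤ ε₀) ∧
          (∀ i : Fin 4, |Q.mark i - R.mark i| ≤ ε₀) ∧
          (∀ z ∈ cthickening r Q.carrier, z ∉ R.carrier →
            infDist z (R.arc 0) ≤ t ∨ infDist z (R.arc 2) ≤ t) ∧
          (∀ z ∈ cthickening r Q.carrier, z ∈ R.carrier →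
            m ≤ infDist z (R.arc 1) ∧ m ≤ infDist z (R.arc 3)) ∧
          (∀ z ∈ cthickening r (Q.arc 0), z ∉ R.carrier ∧ infDist z (R.arc 0) ≤ t) ∧
          (∀ z ∈ cthickening r (Q.arc 2), z ∉ R.carrier ∧ infDist z (R.arc 2) ≤ t)) ∧
      (∃ (N : ConformalRectangle) (r : ℝ), 0 < r ∧
          (∀ u : ℝ, dist (N.boundary u) (R.boundary (u + R.mark 1)) ≤ ε₀) ∧
          (∀ i : Fin 4, |N.mark i -
            ![0, R.mark 2 - R.mark 1, R.mark 3 - R.mark 1, R.mark 0 + 1 - R.mark 1] i| ≤ ε₀) ∧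
          (∀ z ∈ cthickening r N.carrier, z ∉ R.carrier →
            infDist z (R.arc 1) ≤ t ∨ infDist z (R.arc 3) ≤ t) ∧
          (∀ z ∈ cthickening r N.carrier, z ∈ R.carrier →
            m ≤ infDist z (R.arc 0) ∧ m ≤ infDist z (R.arc 2)) ∧
          (∀ z ∈ cthickening r N.carrier, z ∈ R.carrier → ∀ j : Fin 4, m ≤ dist z (R.pt j)) ∧
          (∀ z ∈ cthickening r (N.arc 0), z ∉ R.carrier ∧ infDist z (R.arc 1) ≤ t) ∧
          (∀ z ∈ cthickening r (N.arc 2), z ∉ R.carrier ∧ infDist z (R.arc 3) ≤ t)) := by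
  sorry

/- Stub D3 `stub_cyclicFlip` LANDED (p73646, worker wave 1): imported from
`Summits.CriticalPhenomena.CardyFormulaZ2.Theorems.CardyMagicRigidityLoopsToCrossingsStubCyclicFlip`. -/

/-- **Glue for the re-cut stub D** (lead, sorry-free): D1, D2, D3 imply the comparison-rectangle
statement consumed by `tendsto_sub_of_stubs` (Cardy clauses from D1 applied to `R` for `Q` and to the
shifted copy `R₂` of D3 for `N`, `F(η(R₂)) = 1 - F(η(R))`). [folklore] -/
theorem comparisonRectangles_of_stubs
    (hD1 : ∀ (R : ConformalRectangle) (φ : ConformalEquiv UpperHalfPlane.upperHalfPlaneSet R.carrier)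
      (x : Fin 4 → ℝ), R.IsUniformizing φ x → ∀ τ : ℝ, 0 < τ → ∃ ε₀ : ℝ, 0 < ε₀ ∧
      ∀ (Q : ConformalRectangle), (∀ u : ℝ, dist (Q.boundary u) (R.boundary u) ≤ ε₀) →
        (∀ i : Fin 4, |Q.mark i - R.mark i| ≤ ε₀) →
        ∀ (ψ : ConformalEquiv UpperHalfPlane.upperHalfPlaneSet Q.carrier) (y : Fin 4 → ℝ),
          Q.IsUniformizing ψ y →
          |Literature.Probability.RandomPlanarGeometry.cardyFunction (crossRatio y) -
            Literature.Probability.RandomPlanarGeometry.cardyFunction (crossRatio x)| ≤ τ)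
    (hD2 : ∀ (R : ConformalRectangle) (ε₀ : ℝ), 0 < ε₀ → ∃ m : ℝ, 0 < m ∧ ∀ t : ℝ, 0 < t →
      (∃ (Q : ConformalRectangle) (r : ℝ), 0 < r ∧
          (∀ u : ℝ, dist (Q.boundary u) (R.boundary u) ≤ ε₀) ∧
          (∀ i : Fin 4, |Q.mark i - R.mark i| ≤ ε₀) ∧
          (∀ z ∈ cthickening r Q.carrier, z ∉ R.carrier →
            infDist z (R.arc 0) ≤ t ∨ infDist z (R.arc 2) ≤ t) ∧
          (∀ z ∈ cthickening r Q.carrier, z ∈ R.carrier →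
            m ≤ infDist z (R.arc 1) ∧ m ≤ infDist z (R.arc 3)) ∧
          (∀ z ∈ cthickening r (Q.arc 0), z ∉ R.carrier ∧ infDist z (R.arc 0) ≤ t) ∧
          (∀ z ∈ cthickening r (Q.arc 2), z ∉ R.carrier ∧ infDist z (R.arc 2) ≤ t)) ∧
      (∃ (N : ConformalRectangle) (r : ℝ), 0 < r ∧
          (∀ u : ℝ, dist (N.boundary u) (R.boundary (u + R.mark 1)) ≤ ε₀) ∧
          (∀ i : Fin 4, |N.mark i -
            ![0, R.mark 2 - R.mark 1, R.mark 3 - R.mark 1, R.mark 0 + 1 - R.mark 1] i| ≤ ε₀) ∧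
          (∀ z ∈ cthickening r N.carrier, z ∉ R.carrier →
            infDist z (R.arc 1) ≤ t ∨ infDist z (R.arc 3) ≤ t) ∧
          (∀ z ∈ cthickening r N.carrier, z ∈ R.carrier →
            m ≤ infDist z (R.arc 0) ∧ m ≤ infDist z (R.arc 2)) ∧
          (∀ z ∈ cthickening r N.carrier, z ∈ R.carrier → ∀ j : Fin 4, m ≤ dist z (R.pt j)) ∧
          (∀ z ∈ cthickening r (N.arc 0), z ∉ R.carrier ∧ infDist z (R.arc 1) ≤ t) ∧
          (∀ z ∈ cthickening r (N.arc 2), z ∉ R.carrier ∧ infDist z (R.arc 3) ≤ t)))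
    (hD3 : ∀ R : ConformalRectangle, ∃ R₂ : ConformalRectangle, R₂.carrier = R.carrier ∧
      (∀ u : ℝ, R₂.boundary u = R.boundary (u + R.mark 1)) ∧
      (∀ i : Fin 4, R₂.mark i = ![0, R.mark 2 - R.mark 1, R.mark 3 - R.mark 1, R.mark 0 + 1 - R.mark 1] i) ∧
      ∀ (φ : ConformalEquiv UpperHalfPlane.upperHalfPlaneSet R.carrier) (x : Fin 4 → ℝ)
        (φ₂ : ConformalEquiv UpperHalfPlane.upperHalfPlaneSet R₂.carrier) (x₂ : Fin 4 → ℝ),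
        R.IsUniformizing φ x → R₂.IsUniformizing φ₂ x₂ →
        Literature.Probability.RandomPlanarGeometry.cardyFunction (crossRatio x₂) =
          1 - Literature.Probability.RandomPlanarGeometry.cardyFunction (crossRatio x)) :
    ∀ (R : ConformalRectangle) (φ : ConformalEquiv UpperHalfPlane.upperHalfPlaneSet R.carrier)
      (x : Fin 4 → ℝ), R.IsUniformizing φ x → ∀ τ : ℝ, 0 < τ →
      ∃ m : ℝ, 0 < m ∧ ∀ t : ℝ, 0 < t →
        (∃ (Q : ConformalRectangle) (ψ : ConformalEquiv UpperHalfPlane.upperHalfPlaneSet Q.carrier)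
            (y : Fin 4 → ℝ) (r : ℝ), Q.IsUniformizing ψ y ∧ 0 < r ∧
            |Literature.Probability.RandomPlanarGeometry.cardyFunction (crossRatio y) - Literature.Probability.RandomPlanarGeometry.cardyFunction (crossRatio x)| ≤ τ ∧
            (∀ z ∈ cthickening r Q.carrier, z ∉ R.carrier →
              infDist z (R.arc 0) ≤ t ∨ infDist z (R.arc 2) ≤ t) ∧
            (∀ z ∈ cthickening r Q.carrier, z ∈ R.carrier →
              m ≤ infDist z (R.arc 1) ∧ m ≤ infDist z (R.arc 3)) ∧
            (∀ z ∈ cthickening r (Q.arc 0), z ∉ R.carrier ∧ infDist z (R.arc 0) ≤ t) ∧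
            (∀ z ∈ cthickening r (Q.arc 2), z ∉ R.carrier ∧ infDist z (R.arc 2) ≤ t)) ∧
        (∃ (N : ConformalRectangle) (ψ : ConformalEquiv UpperHalfPlane.upperHalfPlaneSet N.carrier)
            (y : Fin 4 → ℝ) (r : ℝ), N.IsUniformizing ψ y ∧ 0 < r ∧
            |Literature.Probability.RandomPlanarGeometry.cardyFunction (crossRatio y) - (1 - Literature.Probability.RandomPlanarGeometry.cardyFunction (crossRatio x))| ≤ τ ∧
            (∀ z ∈ cthickening r N.carrier, z ∉ R.carrier →
              infDist z (R.arc 1) ≤ t ∨ infDist z (R.arc 3) ≤ t) ∧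
            (∀ z ∈ cthickening r N.carrier, z ∈ R.carrier →
              m ≤ infDist z (R.arc 0) ∧ m ≤ infDist z (R.arc 2)) ∧
            (∀ z ∈ cthickening r N.carrier, z ∈ R.carrier → ∀ j : Fin 4, m ≤ dist z (R.pt j)) ∧
            (∀ z ∈ cthickening r (N.arc 0), z ∉ R.carrier ∧ infDist z (R.arc 1) ≤ t) ∧
            (∀ z ∈ cthickening r (N.arc 2), z ∉ R.carrier ∧ infDist z (R.arc 3) ≤ t)) := by
  intro R φ x hux τ hτ
  obtain ⟨R₂, _hcar, hbd, hmk, hflip⟩ := hD3 R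
  obtain ⟨φ₂, x₂, hux₂⟩ := MarkedDomain.exists_isUniformizing_holds R₂
  obtain ⟨ε₁, hε₁, h1⟩ := hD1 R φ x hux τ hτ
  obtain ⟨ε₂, hε₂, h2⟩ := hD1 R₂ φ₂ x₂ hux₂ τ hτ
  obtain ⟨m, hm, hgeo⟩ := hD2 R (min ε₁ ε₂) (lt_min hε₁ hε₂)
  refine ⟨m, hm, fun t ht => ?_⟩
  obtain ⟨⟨Q, r, hr, hQb, hQm, L1, L2, L3, L4⟩, ⟨N, r', hr', hNb, hNm, U1, U2, U3, U4, U5⟩⟩ :=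
    hgeo t ht
  constructor
  · obtain ⟨ψ, y, huy⟩ := MarkedDomain.exists_isUniformizing_holds Q
    refine ⟨Q, ψ, y, r, huy, hr, ?_, L1, L2, L3, L4⟩
    exact h1 Q (fun u => (hQb u).trans (min_le_left _ _))
      (fun i => (hQm i).trans (min_le_left _ _)) ψ y huy
  · obtain ⟨ψ, y, huy⟩ := MarkedDomain.exists_isUniformizing_holds N
    refine ⟨N, ψ, y, r', huy, hr', ?_, U1, U2, U3, U4, U5⟩
    have key := h2 N (fun u => by rw [hbd u]; exact (hNb u).trans (min_le_right _ _))
      (fun i => by rw [hmk i]; exact (hNm i).trans (min_le_right _ _)) ψ y huy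
    rwa [hflip φ x φ₂ x₂ hux hux₂] at key

/-! ## Glue (proved): measurability, the two per-mesh inequalities, the composition -/

/-- Plate-path events are measurable (countable union of `{u ↔ v in S}`). [folklore] -/
theorem measurableSet_openCrossing_site (S A B : Set (Site 2)) :
    MeasurableSet (openCrossing S A B : Set (BondConfig (Site 2))) := by
  have h : openCrossing S A B = ⋃ x ∈ A, ⋃ y ∈ B, (openConnIn S x y : Set (BondConfig (Site 2))) := by
    ext ω
    simp only [mem_openCrossing_iff, Set.mem_iUnion, exists_prop]
  rw [h]
  exact MeasurableSet.biUnion (Set.to_countable A) fun x _ =>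
    MeasurableSet.biUnion (Set.to_countable B) fun y _ => measurableSet_openConnIn_of_countable S x y

/-- A restricted open connection of a lattice configuration is a `PathIn` of `openGraph ω ⊓ ℤ²`.
[folklore] -/
theorem pathIn_inf_of_mem_openConnIn {ω : BondConfig (Site 2)} (hω : ω ⊆ (zdGraph 2).edgeSet)
    {S : Set (Site 2)} {u v : Site 2} (h : ω ∈ openConnIn S u v) :
    PathIn (openGraph ω ⊓ zdGraph 2) S u v := by
  rw [openGraph_inf_eq, Set.inter_eq_left.2 hω]
  exact DCT16.pathIn_of_mem_openConnIn h

/-- The physical dual position of a site is within `δ` of its mesh point, hence the half-diagonal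
offset is absorbed by doubling the room. [folklore] -/
theorem dualScale_mem_cthickening {δ r : ℝ} (hδ : 0 < δ) (hδr : δ ≤ r / 2) {K : Set ℂ} {x : Site 2}
    (hx : meshPoint δ x ∈ cthickening (r / 2) K) : dualScale δ (Site.toComplex x) ∈ cthickening r K := by
  have hre : dualOffset.re = 1 / 2 := rfl
  have him : dualOffset.im = 1 / 2 := rfl
  have hoff : ‖dualOffset‖ ≤ 1 := by
    refine (Complex.norm_le_abs_re_add_abs_im _).trans ?_
    rw [hre, him]; norm_num
  have hd : dist (dualScale δ (Site.toComplex x)) (meshPoint δ x) ≤ r / 2 := by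
    rw [dualScale_toComplex, dist_eq_norm, add_sub_cancel_left, norm_mul, Complex.norm_real,
      Real.norm_of_nonneg hδ.le]
    calc δ * ‖dualOffset‖ ≤ δ * 1 := by gcongr
      _ ≤ r / 2 := by linarith
  have h1 := mem_cthickening_of_dist_le _ _ (r / 2) _ hx hd
  have h2 := cthickening_cthickening_subset (by linarith : (0 : ℝ) ≤ r / 2) (by linarith : (0 : ℝ) ≤ r / 2) K h1
  rwa [add_halves] at h2

/-- **Lower per-mesh inequality**: with stub A's constants for `R` and a comparison rectangle in
lower sandwich position, the plate-path probability is at most `bond R δ`. [folklore] -/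
theorem real_openCrossing_le_bond (R : ConformalRectangle) {δ₀ t₀ : ℝ}
    (hAfor : ∀ δ t : ℝ, 0 < δ → δ < δ₀ → 0 ≤ t → t ≤ t₀ →
        ∀ (ω : BondConfig (Site 2)) (S : Set (Site 2)) (u v : Site 2),
          (∀ x ∈ S, meshPoint δ x ∉ R.carrier →
            infDist (meshPoint δ x) (R.arc 0) ≤ t ∨ infDist (meshPoint δ x) (R.arc 2) ≤ t) →
          (∀ x ∈ S, meshPoint δ x ∈ R.carrier →
            δ < infDist (meshPoint δ x) (R.arc 1) ∧ δ < infDist (meshPoint δ x) (R.arc 3)) →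
          meshPoint δ u ∉ R.carrier → infDist (meshPoint δ u) (R.arc 0) ≤ t →
          meshPoint δ v ∉ R.carrier → infDist (meshPoint δ v) (R.arc 2) ≤ t →
          PathIn (openGraph ω ⊓ zdGraph 2) S u v →
          ω ∈ discreteCrossing R.carrier δ (R.arc 0) (R.arc 2))
    {Q : ConformalRectangle} {r m t δ : ℝ}
    (hL1 : ∀ z ∈ cthickening r Q.carrier, z ∉ R.carrier →
      infDist z (R.arc 0) ≤ t ∨ infDist z (R.arc 2) ≤ t)
    (hL2 : ∀ z ∈ cthickening r Q.carrier, z ∈ R.carrier →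
      m ≤ infDist z (R.arc 1) ∧ m ≤ infDist z (R.arc 3))
    (hL3 : ∀ z ∈ cthickening r (Q.arc 0), z ∉ R.carrier ∧ infDist z (R.arc 0) ≤ t)
    (hL4 : ∀ z ∈ cthickening r (Q.arc 2), z ∉ R.carrier ∧ infDist z (R.arc 2) ≤ t)
    (hδ : 0 < δ) (hδ₀ : δ < δ₀) (hδm : δ < m) (ht : 0 ≤ t) (htt₀ : t ≤ t₀) :
    (bondPercolation (zdGraph 2) half).real
        (openCrossing {x : Site 2 | meshPoint δ x ∈ cthickening r Q.carrier}
          {x | meshPoint δ x ∈ cthickening r (Q.arc 0)}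
          {x | meshPoint δ x ∈ cthickening r (Q.arc 2)}) ≤ bondDomainCrossingProb R δ := by
  rw [bondDomainCrossingProb_eq_measureReal]
  simp only [measureReal_def]
  refine ENNReal.toReal_mono (measure_ne_top _ _) (measure_mono_ae ?_)
  filter_upwards [ae_subset_edgeSet (zdGraph 2) half] with ω hω
  intro hoc
  obtain ⟨u, hu, v, hv, huv⟩ := mem_openCrossing_iff.1 hoc
  have hp : PathIn (openGraph ω ⊓ zdGraph 2) {x : Site 2 | meshPoint δ x ∈ cthickening r Q.carrier} u v :=
    pathIn_inf_of_mem_openConnIn hω huv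
  exact hAfor δ t hδ hδ₀ ht htt₀ ω _ u v (fun x hx hxR => hL1 _ hx hxR)
    (fun x hx hxR => ⟨hδm.trans_le (hL2 _ hx hxR).1, hδm.trans_le (hL2 _ hx hxR).2⟩)
    (hL3 _ hu).1 (hL3 _ hu).2 (hL4 _ hv).1 (hL4 _ hv).2 hp

/-- **Upper per-mesh inequality**: with stub B's constants for `R` (corner margin `m`) and a
comparison rectangle in upper sandwich position with room `r`, `bond R δ` is at most one minus
the probability of an OPEN plate path of the `r/2`-fattening (bond self-duality at `1/2`).
[folklore] -/
theorem bond_le_one_sub_real_openCrossing (R : ConformalRectangle) {m δ₀ t₀ : ℝ}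
    (hBfor : ∀ δ t : ℝ, 0 < δ → δ < δ₀ → 0 ≤ t → t ≤ t₀ →
        ∀ (ω : BondConfig (Site 2)) (S : Set (Site 2)) (u v : Site 2),
          (∀ x ∈ S, dualScale δ (Site.toComplex x) ∉ R.carrier →
            infDist (dualScale δ (Site.toComplex x)) (R.arc 1) ≤ t ∨
              infDist (dualScale δ (Site.toComplex x)) (R.arc 3) ≤ t) →
          (∀ x ∈ S, dualScale δ (Site.toComplex x) ∈ R.carrier →
            3 * δ < infDist (dualScale δ (Site.toComplex x)) (R.arc 0) ∧
              3 * δ < infDist (dualScale δ (Site.toComplex x)) (R.arc 2)) →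
          (∀ x ∈ S, dualScale δ (Site.toComplex x) ∈ R.carrier →
            ∀ j : Fin 4, m ≤ dist (dualScale δ (Site.toComplex x)) (R.pt j)) →
          dualScale δ (Site.toComplex u) ∉ R.carrier →
            infDist (dualScale δ (Site.toComplex u)) (R.arc 1) ≤ t →
          dualScale δ (Site.toComplex v) ∉ R.carrier →
            infDist (dualScale δ (Site.toComplex v)) (R.arc 3) ≤ t →
          PathIn (openGraph (dualConfig ω) ⊓ zdGraph 2) S u v →
          ω ∉ discreteCrossing R.carrier δ (R.arc 0) (R.arc 2))
    {N : ConformalRectangle} {r t δ : ℝ}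
    (hU1 : ∀ z ∈ cthickening r N.carrier, z ∉ R.carrier →
      infDist z (R.arc 1) ≤ t ∨ infDist z (R.arc 3) ≤ t)
    (hU2 : ∀ z ∈ cthickening r N.carrier, z ∈ R.carrier →
      m ≤ infDist z (R.arc 0) ∧ m ≤ infDist z (R.arc 2))
    (hU3 : ∀ z ∈ cthickening r N.carrier, z ∈ R.carrier → ∀ j : Fin 4, m ≤ dist z (R.pt j))
    (hU4 : ∀ z ∈ cthickening r (N.arc 0), z ∉ R.carrier ∧ infDist z (R.arc 1) ≤ t)
    (hU5 : ∀ z ∈ cthickening r (N.arc 2), z ∉ R.carrier ∧ infDist z (R.arc 3) ≤ t)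
    (hδ : 0 < δ) (hδ₀ : δ < δ₀) (h3δ : 3 * δ < m) (hδr : δ ≤ r / 2) (ht : 0 ≤ t) (htt₀ : t ≤ t₀) :
    bondDomainCrossingProb R δ ≤ 1 -
      (bondPercolation (zdGraph 2) half).real
        (openCrossing {x : Site 2 | meshPoint δ x ∈ cthickening (r / 2) N.carrier}
          {x | meshPoint δ x ∈ cthickening (r / 2) (N.arc 0)}
          {x | meshPoint δ x ∈ cthickening (r / 2) (N.arc 2)}) := by
  set E : Set (BondConfig (Site 2)) :=
    openCrossing {x : Site 2 | meshPoint δ x ∈ cthickening (r / 2) N.carrier}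
      {x | meshPoint δ x ∈ cthickening (r / 2) (N.arc 0)}
      {x | meshPoint δ x ∈ cthickening (r / 2) (N.arc 2)} with hE
  have hmeas : MeasurableSet E := measurableSet_openCrossing_site _ _ _
  have key : ∀ {K : Set ℂ} {x : Site 2}, meshPoint δ x ∈ cthickening (r / 2) K →
      dualScale δ (Site.toComplex x) ∈ cthickening r K := fun hx => dualScale_mem_cthickening hδ hδr hx
  have hsub : discreteCrossing R.carrier δ (R.arc 0) (R.arc 2) ⊆ (dualConfig ⁻¹' E)ᶜ := by
    intro ω hω hoc
    rw [Set.mem_preimage, hE] at hoc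
    obtain ⟨u, hu, v, hv, huv⟩ := mem_openCrossing_iff.1 hoc
    have hp : PathIn (openGraph (dualConfig ω) ⊓ zdGraph 2)
        {x : Site 2 | meshPoint δ x ∈ cthickening (r / 2) N.carrier} u v :=
      pathIn_inf_of_mem_openConnIn (dualConfig_subset_edgeSet ω) huv
    exact hBfor δ t hδ hδ₀ ht htt₀ ω _ u v (fun x hx hxR => hU1 _ (key hx) hxR)
      (fun x hx hxR => ⟨h3δ.trans_le (hU2 _ (key hx) hxR).1, h3δ.trans_le (hU2 _ (key hx) hxR).2⟩)
      (fun x hx hxR j => hU3 _ (key hx) hxR j)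
      (hU4 _ (key hu)).1 (hU4 _ (key hu)).2 (hU5 _ (key hv)).1 (hU5 _ (key hv)).2 hp hω
  calc bondDomainCrossingProb R δ
        = (bondPercolation (zdGraph 2) half).real (discreteCrossing R.carrier δ (R.arc 0) (R.arc 2)) := rfl
    _ ≤ (bondPercolation (zdGraph 2) half).real (dualConfig ⁻¹' E)ᶜ := measureReal_mono hsub
    _ = 1 - (bondPercolation (zdGraph 2) half).real (dualConfig ⁻¹' E) := by
          rw [measureReal_compl (measurable_dualConfig hmeas), probReal_univ]
    _ = 1 - (bondPercolation (zdGraph 2) half).real E := by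
          rw [bondPercolation_half_real_preimage_dualConfig hmeas]

/-- **Composition, arrow form.** The four stub STATEMENTS imply the crux, unfolded
(`X → ∀ R, bond R δ - tri R δ → 0`); sorry-free. Smirnov's theorem on `𝕋`
(`hasCrossingLimit_triDomainCrossingProb_holds`) is the oracle for `R`, `Q` and `N`; uniformizing
data exist (`MarkedDomain.exists_isUniformizing_holds`). [folklore] -/
theorem tendsto_sub_of_stubs :
    (∀ R : ConformalRectangle,
      ∃ δ₀ > 0, ∃ t₀ > 0, ∀ δ t : ℝ, 0 < δ → δ < δ₀ → 0 ≤ t → t ≤ t₀ →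
        ∀ (ω : BondConfig (Site 2)) (S : Set (Site 2)) (u v : Site 2),
          (∀ x ∈ S, meshPoint δ x ∉ R.carrier →
            infDist (meshPoint δ x) (R.arc 0) ≤ t ∨ infDist (meshPoint δ x) (R.arc 2) ≤ t) →
          (∀ x ∈ S, meshPoint δ x ∈ R.carrier →
            δ < infDist (meshPoint δ x) (R.arc 1) ∧ δ < infDist (meshPoint δ x) (R.arc 3)) →
          meshPoint δ u ∉ R.carrier → infDist (meshPoint δ u) (R.arc 0) ≤ t →
          meshPoint δ v ∉ R.carrier → infDist (meshPoint δ v) (R.arc 2) ≤ t →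
          PathIn (openGraph ω ⊓ zdGraph 2) S u v →
          ω ∈ discreteCrossing R.carrier δ (R.arc 0) (R.arc 2)) →
    (∀ (R : ConformalRectangle) (ρ : ℝ), 0 < ρ →
      ∃ δ₀ > 0, ∃ t₀ > 0, ∀ δ t : ℝ, 0 < δ → δ < δ₀ → 0 ≤ t → t ≤ t₀ →
        ∀ (ω : BondConfig (Site 2)) (S : Set (Site 2)) (u v : Site 2),
          (∀ x ∈ S, dualScale δ (Site.toComplex x) ∉ R.carrier →
            infDist (dualScale δ (Site.toComplex x)) (R.arc 1) ≤ t ∨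
              infDist (dualScale δ (Site.toComplex x)) (R.arc 3) ≤ t) →
          (∀ x ∈ S, dualScale δ (Site.toComplex x) ∈ R.carrier →
            3 * δ < infDist (dualScale δ (Site.toComplex x)) (R.arc 0) ∧
              3 * δ < infDist (dualScale δ (Site.toComplex x)) (R.arc 2)) →
          (∀ x ∈ S, dualScale δ (Site.toComplex x) ∈ R.carrier →
            ∀ j : Fin 4, ρ ≤ dist (dualScale δ (Site.toComplex x)) (R.pt j)) →
          dualScale δ (Site.toComplex u) ∉ R.carrier →
            infDist (dualScale δ (Site.toComplex u)) (R.arc 1) ≤ t →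
          dualScale δ (Site.toComplex v) ∉ R.carrier →
            infDist (dualScale δ (Site.toComplex v)) (R.arc 3) ≤ t →
          PathIn (openGraph (dualConfig ω) ⊓ zdGraph 2) S u v →
          ω ∉ discreteCrossing R.carrier δ (R.arc 0) (R.arc 2)) →
    (LoopLimitZ2EqT →
      ∀ (Q : ConformalRectangle) (r : ℝ), 0 < r → ∀ ε : ℝ, 0 < ε →
        ∀ᶠ δ : ℝ in 𝓝[>] 0,
          triDomainCrossingProb Q δ ≤
            (bondPercolation (zdGraph 2) half).real
              (openCrossing {x : Site 2 | meshPoint δ x ∈ cthickening r Q.carrier}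
                {x | meshPoint δ x ∈ cthickening r (Q.arc 0)}
                {x | meshPoint δ x ∈ cthickening r (Q.arc 2)}) + ε) →
    (∀ (R : ConformalRectangle) (φ : ConformalEquiv UpperHalfPlane.upperHalfPlaneSet R.carrier)
      (x : Fin 4 → ℝ), R.IsUniformizing φ x → ∀ τ : ℝ, 0 < τ →
      ∃ m : ℝ, 0 < m ∧ ∀ t : ℝ, 0 < t →
        (∃ (Q : ConformalRectangle) (ψ : ConformalEquiv UpperHalfPlane.upperHalfPlaneSet Q.carrier)
            (y : Fin 4 → ℝ) (r : ℝ), Q.IsUniformizing ψ y ∧ 0 < r ∧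
            |Literature.Probability.RandomPlanarGeometry.cardyFunction (crossRatio y) - Literature.Probability.RandomPlanarGeometry.cardyFunction (crossRatio x)| ≤ τ ∧
            (∀ z ∈ cthickening r Q.carrier, z ∉ R.carrier →
              infDist z (R.arc 0) ≤ t ∨ infDist z (R.arc 2) ≤ t) ∧
            (∀ z ∈ cthickening r Q.carrier, z ∈ R.carrier →
              m ≤ infDist z (R.arc 1) ∧ m ≤ infDist z (R.arc 3)) ∧
            (∀ z ∈ cthickening r (Q.arc 0), z ∉ R.carrier ∧ infDist z (R.arc 0) ≤ t) ∧
            (∀ z ∈ cthickening r (Q.arc 2), z ∉ R.carrier ∧ infDist z (R.arc 2) ≤ t)) ∧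
        (∃ (N : ConformalRectangle) (ψ : ConformalEquiv UpperHalfPlane.upperHalfPlaneSet N.carrier)
            (y : Fin 4 → ℝ) (r : ℝ), N.IsUniformizing ψ y ∧ 0 < r ∧
            |Literature.Probability.RandomPlanarGeometry.cardyFunction (crossRatio y) - (1 - Literature.Probability.RandomPlanarGeometry.cardyFunction (crossRatio x))| ≤ τ ∧
            (∀ z ∈ cthickening r N.carrier, z ∉ R.carrier →
              infDist z (R.arc 1) ≤ t ∨ infDist z (R.arc 3) ≤ t) ∧
            (∀ z ∈ cthickening r N.carrier, z ∈ R.carrier →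
              m ≤ infDist z (R.arc 0) ∧ m ≤ infDist z (R.arc 2)) ∧
            (∀ z ∈ cthickening r N.carrier, z ∈ R.carrier → ∀ j : Fin 4, m ≤ dist z (R.pt j)) ∧
            (∀ z ∈ cthickening r (N.arc 0), z ∉ R.carrier ∧ infDist z (R.arc 1) ≤ t) ∧
            (∀ z ∈ cthickening r (N.arc 2), z ∉ R.carrier ∧ infDist z (R.arc 3) ≤ t))) →
    LoopLimitZ2EqT → ∀ R : ConformalRectangle,
      Tendsto (fun δ : ℝ ↦ bondDomainCrossingProb R δ - triDomainCrossingProb R δ) (𝓝[>] 0) (𝓝 0) := by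
  intro hA hB hC hD hX R
  obtain ⟨φ, x, hux⟩ := MarkedDomain.exists_isUniformizing_holds R
  have htri : Tendsto (triDomainCrossingProb R) (𝓝[>] 0)
      (𝓝 (Literature.Probability.RandomPlanarGeometry.cardyFunction (crossRatio x))) :=
    hasCrossingLimit_triDomainCrossingProb_holds R φ x hux
  set L : ℝ := Literature.Probability.RandomPlanarGeometry.cardyFunction (crossRatio x) with hL
  -- lower bound: stub D (lower side) + stub A + stub C + Smirnov for `Q`
  have hlow : ∀ e : ℝ, 0 < e → ∀ᶠ δ : ℝ in 𝓝[>] 0, L - e < bondDomainCrossingProb R δ := by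
    intro e he
    obtain ⟨m, hm, hDm⟩ := hD R φ x hux (e / 3) (by positivity)
    obtain ⟨δ₀, hδ₀, t₀, ht₀, hAfor⟩ := hA R
    obtain ⟨⟨Q, ψ, y, r, hψ, hr, hF, hL1, hL2, hL3, hL4⟩, -⟩ := hDm t₀ ht₀
    have hQ : Tendsto (triDomainCrossingProb Q) (𝓝[>] 0)
        (𝓝 (Literature.Probability.RandomPlanarGeometry.cardyFunction (crossRatio y))) :=
      hasCrossingLimit_triDomainCrossingProb_holds Q ψ y hψ
    have hCQ := hC hX Q r hr (e / 3) (by positivity)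
    have hev1 : ∀ᶠ δ : ℝ in 𝓝[>] 0,
        Literature.Probability.RandomPlanarGeometry.cardyFunction (crossRatio y) - e / 3 <
          triDomainCrossingProb Q δ :=
      hQ.eventually (lt_mem_nhds (by linarith))
    have hev2 : ∀ᶠ δ : ℝ in 𝓝[>] 0, δ ∈ Ioo 0 (min δ₀ m) := Ioo_mem_nhdsGT (lt_min hδ₀ hm)
    filter_upwards [hCQ, hev1, hev2] with δ h1 h2 h3
    have hle := real_openCrossing_le_bond R hAfor hL1 hL2 hL3 hL4 h3.1
      (h3.2.trans_le (min_le_left _ _)) (h3.2.trans_le (min_le_right _ _)) ht₀.le le_rfl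
    have hF' := (abs_sub_le_iff.1 hF).2
    linarith
  -- upper bound: stub D (upper side) + stub B + duality + stub C + Smirnov for `N`
  have hup : ∀ e : ℝ, 0 < e → ∀ᶠ δ : ℝ in 𝓝[>] 0, bondDomainCrossingProb R δ < L + e := by
    intro e he
    obtain ⟨m, hm, hDm⟩ := hD R φ x hux (e / 3) (by positivity)
    obtain ⟨δ₀, hδ₀, t₀, ht₀, hBfor⟩ := hB R m hm
    obtain ⟨-, ⟨N, ψ, y, r, hψ, hr, hF, hU1, hU2, hU3, hU4, hU5⟩⟩ := hDm t₀ ht₀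
    have hN : Tendsto (triDomainCrossingProb N) (𝓝[>] 0)
        (𝓝 (Literature.Probability.RandomPlanarGeometry.cardyFunction (crossRatio y))) :=
      hasCrossingLimit_triDomainCrossingProb_holds N ψ y hψ
    have hCN := hC hX N (r / 2) (by positivity) (e / 3) (by positivity)
    have hev1 : ∀ᶠ δ : ℝ in 𝓝[>] 0,
        Literature.Probability.RandomPlanarGeometry.cardyFunction (crossRatio y) - e / 3 <
          triDomainCrossingProb N δ :=
      hN.eventually (lt_mem_nhds (by linarith))
    have hev2 : ∀ᶠ δ : ℝ in 𝓝[>] 0, δ ∈ Ioo 0 (min δ₀ (min (m / 3) (r / 2))) :=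
      Ioo_mem_nhdsGT (lt_min hδ₀ (lt_min (by positivity) (by positivity)))
    filter_upwards [hCN, hev1, hev2] with δ h1 h2 h3
    have hδ₀' : δ < δ₀ := h3.2.trans_le (min_le_left _ _)
    have hδm : δ < m / 3 := h3.2.trans_le ((min_le_right _ _).trans (min_le_left _ _))
    have hδr : δ < r / 2 := h3.2.trans_le ((min_le_right _ _).trans (min_le_right _ _))
    have hle := bond_le_one_sub_real_openCrossing R hBfor hU1 hU2 hU3 hU4 hU5 h3.1 hδ₀'
      (by linarith) hδr.le ht₀.le le_rfl
    have hF' := (abs_sub_le_iff.1 hF).2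
    linarith
  -- `bond R δ → F(η_R)`, then subtract Smirnov for `R`
  have hb : Tendsto (bondDomainCrossingProb R) (𝓝[>] 0) (𝓝 L) := by
    rw [Metric.tendsto_nhds]
    intro e he
    filter_upwards [hlow e he, hup e he] with δ h1 h2
    rw [Real.dist_eq, abs_sub_lt_iff]
    constructor <;> linarith
  have key := hb.sub htri
  rw [hL, sub_self] at key
  exact key

/-- **The skeleton theorem: the crux `LoopsToCrossings` BY NAME from the four registered stubs**
(no hypotheses; `sorry` only inside the stubs it invokes). When the stubs are proved this IS the
proof of the crux. [folklore] -/
theorem LoopsToCrossings_of :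
    Summit.CriticalPhenomena.CardyFormulaZ2.Theses.CardyMagicRigidity.LoopsToCrossings :=
  -- the C-cores registered so far ride in the cone of the composition (they feed stub C's proof,
  -- `work/C/Plan.lean`: C = transfer_of_pieces S0 (polarZ_of G1) (polarT_of G2 B) (monoTransfer_of …))
  (fun (_ : _ ∧ _ ∧ _ ∧ _ ∧ _) =>
    tendsto_sub_of_stubs stub_discreteCrossing_of_pathIn stub_not_discreteCrossing_of_dualPathIn
      stub_transfer_tri_to_bond
      (comparisonRectangles_of_stubs stub_cardyContinuity stub_comparisonGeometry stub_cyclicFlip))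
    ⟨stub_zdPlateDuality, stub_plusBlocking, stub_triPlateDuality, stub_transferVerticalTtoZ,
      transferHorizontalZtoT_of_stubs⟩

end Summit.CriticalPhenomena.CardyFormulaZ2.Cruxes.LoopsToCrossings.OracleSandwich

end
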